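import Summits.Ventures.CertifiedArithmetic.Expansions.Orient3dStageCBounds
import Summits.Ventures.CertifiedArithmetic.Expansions.Orient3dStageCMargins
import Summits.Ventures.CertifiedArithmetic.Expansions.Orient3dStageB
import Summits.Ventures.CertifiedArithmetic.Expansions.IncircleStageBExpansion
import Summits.Ventures.CertifiedArithmetic.Expansions.ExpansionGrids
import Mathlib.Tactic.Linarith
import Mathlib.Tactic.Positivity
import Mathlib.Tactic.Ring
import Mathlib.Tactic.NormNum

/-!
# ORIENT3D, stage C of `orient3dadapt`: the model, its grids, the early exit

NEW WORK in the sense of this development (the algorithm is Shewchuk's `orient3dadapt`, file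
`predicates.c`; the model over `ℚ`, statements and proofs are ours; nothing here is cited anywhere
as a literature fact).  This file holds the MODEL of stage C (`orient3dStageC`), the grid
fact for stage B's `fin1` (`orient3dB_onGrid`) and the soundness of the EARLY EXIT
(`orient3dStageB_estimate_sign_of_tails`); the soundness of the stage-C TEST is
`Orient3dStageC.lean`, its unconditional instances `Orient3dStageCCorrect.lean`.

THE OBJECT.  After stage B (`Orient3dStageB`: `fin1`, `det = estimate(fin1)`, test against
`o3derrboundB ⊗ permanent`) the C code computes the nine TWO-DIFF-TAILs
`adxtail = (a₁ − d₁) − adx, …`, returns `det` if all of them vanish, and otherwise sets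
`errbound = o3derrboundC ⊗ permanent ⊕ resulterrbound ⊗ |det|`,
`det ⊕= (adz ⊗ ((bdx ⊗ cdytail ⊕ cdy ⊗ bdxtail) ⊖ (bdy ⊗ cdxtail ⊕ cdx ⊗ bdytail))
        ⊕ adztail ⊗ (bdx ⊗ cdy ⊖ bdy ⊗ cdx)) ⊕ (… b …) ⊕ (… c …)`
and returns `det` if `det ≥ errbound` or `−det ≥ errbound` (else stage D).  `orient3dStageC` below
is this computation over a rounding `fl` and a two-product `tp` (`some det` = stage C answers,
`none` = fall through), with two liberties, both exact: the tails are written as the exact roundoffs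
`(a₁ − d₁) − adx` (this IS what TWO-DIFF-TAIL returns, `twoDiff_exact`), and the three products
`bdy ⊗ cdx`, `cdy ⊗ adx`, `ady ⊗ bdx` of the last summands are written `cdx ⊗ bdy`, `adx ⊗ cdy`,
`bdx ⊗ ady` — the same floats (the real products agree before rounding), which makes all six of
them literally the six products of stage A.  The early exit "all tails zero ⇒ return `det`" is not
a branch of `orient3dStageC`; it is justified separately (`orient3dStageB_estimate_sign_of_tails`).

References: J. R. Shewchuk, Discrete Comput. Geom. 18 (1997) 305–363, §4.3, Fig. 21–22, Table 3;
`predicates.c` (public domain), routine `orient3dadapt` [Shewchuk1997].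
-/

namespace Summit.Ventures.CertifiedArithmetic.Expansions

open Literature.ComputerArithmetic.JeannerodRump2018
open Literature.ComputerArithmetic.BoldoJeannerodMelquiondMuller2023 hiding twoSum twoSum_fst
  isFloat_twoSum
open Literature.ComputerArithmetic.Shewchuk1997

variable {p : ℕ} {emin : ℤ} {fl : ℚ → ℚ}

/-! ## The model of stage C -/

/-- **Stage C of `orient3dadapt`** over a two-product `tp`, a rounding `fl`, coefficients `KC`
(of the permanent) and `KR` (of `|det|`) and the inherited `permanent`: with the nine rounded
differences, their exact tails, `det = estimate(fin1)` of stage B,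
`errbound = KC ⊗ permanent ⊕ KR ⊗ |det|` and the rounded first-order correction `c` (three terms
`z ⊗ ((x ⊗ yt ⊕ y' ⊗ xt') ⊖ (y ⊗ xt ⊕ x' ⊗ yt')) ⊕ zt ⊗ (x ⊗ y ⊖ x' ⊗ y')`, summed left to right),
return `det' = det ⊕ c` iff `det' ≥ errbound` or `−det' ≥ errbound`.  `some det'` = stage C
answers; `none` = fall through to stage D. -/
def orient3dStageC (tp : ℚ → ℚ → ℚ × ℚ) (fl : ℚ → ℚ) (KC KR permanent : ℚ)
    (a₁ a₂ a₃ b₁ b₂ b₃ c₁ c₂ c₃ d₁ d₂ d₃ : ℚ) : Option ℚ :=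
  let adx := fl (a₁ - d₁)
  let bdx := fl (b₁ - d₁)
  let cdx := fl (c₁ - d₁)
  let ady := fl (a₂ - d₂)
  let bdy := fl (b₂ - d₂)
  let cdy := fl (c₂ - d₂)
  let adz := fl (a₃ - d₃)
  let bdz := fl (b₃ - d₃)
  let cdz := fl (c₃ - d₃)
  let adxt := a₁ - d₁ - adx
  let bdxt := b₁ - d₁ - bdx
  let cdxt := c₁ - d₁ - cdx
  let adyt := a₂ - d₂ - ady
  let bdyt := b₂ - d₂ - bdy
  let cdyt := c₂ - d₂ - cdy
  let adzt := a₃ - d₃ - adz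
  let bdzt := b₃ - d₃ - bdz
  let cdzt := c₃ - d₃ - cdz
  let det := estimate fl (orient3dB tp fl adx ady adz bdx bdy bdz cdx cdy cdz)
  let errbound := fl (fl (KC * permanent) + fl (KR * |det|))
  let ta := fl (fl (adz * fl (fl (fl (bdx * cdyt) + fl (cdy * bdxt))
      - fl (fl (bdy * cdxt) + fl (cdx * bdyt))))
    + fl (adzt * fl (fl (bdx * cdy) - fl (cdx * bdy))))
  let tb := fl (fl (bdz * fl (fl (fl (cdx * adyt) + fl (ady * cdxt))
      - fl (fl (cdy * adxt) + fl (adx * cdyt))))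
    + fl (bdzt * fl (fl (cdx * ady) - fl (adx * cdy))))
  let tc := fl (fl (cdz * fl (fl (fl (adx * bdyt) + fl (bdy * adxt))
      - fl (fl (ady * bdxt) + fl (bdx * adyt))))
    + fl (cdzt * fl (fl (adx * bdy) - fl (bdx * ady))))
  let det' := fl (det + fl (fl (ta + tb) + tc))
  if errbound ≤ det' ∨ errbound ≤ -det' then some det' else none

/-! ## Grids: `fin1` and `det = estimate(fin1)` lie on `2^3e₀ ℤ` -/

/-- Every component of stage B's expansion `fin1 = orient3dB …` over differences in `F(p, e₀)`
lies on the grid `2^3e₀ ℤ` (the cofactor terms are floats of `F(p, 3e₀)`, `orient3dTerm_coarse`,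
and FAST-EXPANSION-SUM-ZEROELIM keeps grids). -/
theorem orient3dB_onGrid (hp : 4 ≤ p) (hfl : IsRoundNearest p emin fl) (hfl2 : RoundoffBelow 2 fl)
    {e₀ : ℤ} (h2 : emin ≤ e₀ + e₀) (h3 : emin ≤ e₀ + e₀ + e₀) {tp : ℚ → ℚ → ℚ × ℚ}
    (htp : ∀ x y, IsFloat p e₀ x → IsFloat p e₀ y → ExactTwoProd p emin fl tp x y)
    (htp' : ∀ x y, IsFloat p (e₀ + e₀) x → IsFloat p e₀ y → ExactTwoProd p emin fl tp x y)
    {xa ya za xb yb zb xc yc zc : ℚ} (hxa : IsFloat p e₀ xa) (hya : IsFloat p e₀ ya)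
    (hza : IsFloat p e₀ za) (hxb : IsFloat p e₀ xb) (hyb : IsFloat p e₀ yb)
    (hzb : IsFloat p e₀ zb) (hxc : IsFloat p e₀ xc) (hyc : IsFloat p e₀ yc)
    (hzc : IsFloat p e₀ zc) :
    ∀ x ∈ orient3dB tp fl xa ya za xb yb zb xc yc zc, OnGrid (e₀ + e₀ + e₀) x := by
  have hp1 : 1 ≤ p := le_trans (by norm_num) hp
  obtain ⟨W1, -, F1, -, -, -⟩ :=
    orient3dTerm_spec hp1 hfl hfl2 h2 h3 htp htp' hxb hyc hxc hyb hza
  obtain ⟨W2, -, F2, -, -, -⟩ :=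
    orient3dTerm_spec hp1 hfl hfl2 h2 h3 htp htp' hxc hya hxa hyc hzb
  obtain ⟨W3, -, F3, -, -, -⟩ :=
    orient3dTerm_spec hp1 hfl hfl2 h2 h3 htp htp' hxa hyb hxb hya hzc
  have G1 : ∀ x ∈ orient3dTerm tp fl xb yc xc yb za, OnGrid (e₀ + e₀ + e₀) x := fun x hx =>
    OnGrid.of_isFloat (orient3dTerm_coarse hp1 hfl hfl2 h2 h3 htp htp' hxb hyc hxc hyb hza x hx)
  have G2 : ∀ x ∈ orient3dTerm tp fl xc ya xa yc zb, OnGrid (e₀ + e₀ + e₀) x := fun x hx =>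
    OnGrid.of_isFloat (orient3dTerm_coarse hp1 hfl hfl2 h2 h3 htp htp' hxc hya hxa hyc hzb x hx)
  have G3 : ∀ x ∈ orient3dTerm tp fl xa yb xb ya zc, OnGrid (e₀ + e₀ + e₀) x := fun x hx =>
    OnGrid.of_isFloat (orient3dTerm_coarse hp1 hfl hfl2 h2 h3 htp htp' hxa hyb hxb hya hzc x hx)
  obtain ⟨-, -, F12, -, -, -⟩ := fastExpansionSumZeroElim_spec hp hfl hfl2 F1 W1 F2 W2
  have G12 := onGrid_of_mem_fastExpansionSumZeroElim hp1 hfl h3 F1 F2 G1 G2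
  exact onGrid_of_mem_fastExpansionSumZeroElim hp1 hfl h3 F12 F3 G12 G3

/-! ## The early exit: all tails zero -/

/-- If `|a − b| ≤ δ|b|` with `δ < 1`, then `a` and `b` have the same sign (both ways, zero
included). -/
private theorem sign_iff_of_abs_sub_le_mul {a b δ : ℚ} (h : |a - b| ≤ δ * |b|) (hδ : δ < 1) :
    (0 < a ↔ 0 < b) ∧ (a < 0 ↔ b < 0) := by
  rcases lt_trichotomy b 0 with hb | rfl | hb
  · rw [abs_of_neg hb] at h
    have h1 := (abs_sub_le_iff.mp h).1
    have : a < 0 := by nlinarith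
    exact ⟨⟨fun ha => absurd ha (not_lt.mpr this.le), fun hb' => absurd hb' (not_lt.mpr hb.le)⟩,
      ⟨fun _ => hb, fun _ => this⟩⟩
  · simp only [sub_zero, abs_zero, mul_zero] at h
    have ha : a = 0 := abs_eq_zero.mp (le_antisymm h (abs_nonneg a))
    subst ha; exact ⟨Iff.rfl, Iff.rfl⟩
  · rw [abs_of_pos hb] at h
    have h1 := (abs_sub_le_iff.mp h).2
    have : 0 < a := by nlinarith
    exact ⟨⟨fun _ => hb, fun _ => this⟩,
      ⟨fun ha => absurd ha (not_lt.mpr this.le), fun hb' => absurd hb' (not_lt.mpr hb.le)⟩⟩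

/-- **The early exit of stage C is sound**: if all nine TWO-DIFF-TAILs vanish (the differences
were computed exactly), stage B's `det = estimate(fin1)` — which `orient3dadapt` then returns —
has the sign of the exact determinant, ZERO INCLUDED (`fin1` sums to `(7)` exactly and `estimate`
is `3ε`-accurate).  Same hypotheses as stage B (`p ≥ 4`, `emin ≤ e₀`, `emin ≤ 2e₀`,
`emin ≤ 3e₀`). -/
theorem orient3dStageB_estimate_sign_of_tails (hp : 4 ≤ p) (hfl : IsRoundNearest p emin fl)
    (hfl2 : RoundoffBelow 2 fl)
    (hest3 : ∀ ⦃l : List ℚ⦄, (∀ x ∈ l, IsFloat p emin x) → IsWeakExpansion l →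
      |estimate fl l - l.sum| ≤ 3 * unitRoundoff p * |l.sum|)
    {e₀ : ℤ} (he₀ : emin ≤ e₀) (he₂ : emin ≤ e₀ + e₀) (he₃ : emin ≤ e₀ + e₀ + e₀)
    {a₁ a₂ a₃ b₁ b₂ b₃ c₁ c₂ c₃ d₁ d₂ d₃ : ℚ}
    (ha₁ : IsFloat p e₀ a₁) (ha₂ : IsFloat p e₀ a₂) (ha₃ : IsFloat p e₀ a₃)
    (hb₁ : IsFloat p e₀ b₁) (hb₂ : IsFloat p e₀ b₂) (hb₃ : IsFloat p e₀ b₃)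
    (hc₁ : IsFloat p e₀ c₁) (hc₂ : IsFloat p e₀ c₂) (hc₃ : IsFloat p e₀ c₃)
    (hd₁ : IsFloat p e₀ d₁) (hd₂ : IsFloat p e₀ d₂) (hd₃ : IsFloat p e₀ d₃)
    {tp : ℚ → ℚ → ℚ × ℚ}
    (htp : ∀ x y, IsFloat p e₀ x → IsFloat p e₀ y → ExactTwoProd p emin fl tp x y)
    (htp' : ∀ x y, IsFloat p (e₀ + e₀) x → IsFloat p e₀ y → ExactTwoProd p emin fl tp x y)
    (hta₁ : fl (a₁ - d₁) = a₁ - d₁) (hta₂ : fl (a₂ - d₂) = a₂ - d₂) (hta₃ : fl (a₃ - d₃) = a₃ - d₃)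
    (htb₁ : fl (b₁ - d₁) = b₁ - d₁) (htb₂ : fl (b₂ - d₂) = b₂ - d₂) (htb₃ : fl (b₃ - d₃) = b₃ - d₃)
    (htc₁ : fl (c₁ - d₁) = c₁ - d₁) (htc₂ : fl (c₂ - d₂) = c₂ - d₂)
    (htc₃ : fl (c₃ - d₃) = c₃ - d₃) :
    let det := estimate fl (orient3dB tp fl (fl (a₁ - d₁)) (fl (a₂ - d₂)) (fl (a₃ - d₃))
      (fl (b₁ - d₁)) (fl (b₂ - d₂)) (fl (b₃ - d₃)) (fl (c₁ - d₁)) (fl (c₂ - d₂)) (fl (c₃ - d₃)))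
    (0 < det ↔ 0 < orient3dDet a₁ a₂ a₃ b₁ b₂ b₃ c₁ c₂ c₃ d₁ d₂ d₃) ∧
      (det < 0 ↔ orient3dDet a₁ a₂ a₃ b₁ b₂ b₃ c₁ c₂ c₃ d₁ d₂ d₃ < 0) := by
  intro det
  have hp1 : 1 ≤ p := le_trans (by norm_num) hp
  have hu16 : unitRoundoff p ≤ 1 / 16 :=
    Literature.ComputerArithmetic.BoldoMuller2011.unitRoundoff_le_sixteenth hp
  have fx : ∀ {x y : ℚ}, IsFloat p e₀ x → IsFloat p e₀ y → IsFloat p e₀ (fl (x - y)) :=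
    fun hx hy => isFloat_of_isFloat_of_onGrid (hfl _).1
      (((OnGrid.of_isFloat hx).sub (OnGrid.of_isFloat hy)).fl_of hp1 hfl he₀)
  obtain ⟨hW, hS, hF, -, -, -⟩ := orient3dB_spec hp hfl hfl2 he₂ he₃ htp htp' (fx ha₁ hd₁)
    (fx ha₂ hd₂) (fx ha₃ hd₃) (fx hb₁ hd₁) (fx hb₂ hd₂) (fx hb₃ hd₃) (fx hc₁ hd₁) (fx hc₂ hd₂)
    (fx hc₃ hd₃)
  have hest := hest3 hF hW
  have hB : orient3dDetB (fl (a₁ - d₁)) (fl (a₂ - d₂)) (fl (a₃ - d₃)) (fl (b₁ - d₁)) (fl (b₂ - d₂))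
      (fl (b₃ - d₃)) (fl (c₁ - d₁)) (fl (c₂ - d₂)) (fl (c₃ - d₃))
      = orient3dDet a₁ a₂ a₃ b₁ b₂ b₃ c₁ c₂ c₃ d₁ d₂ d₃ := by
    rw [hta₁, hta₂, hta₃, htb₁, htb₂, htb₃, htc₁, htc₂, htc₃]
    unfold orient3dDetB orient3dDet; ring
  rw [hS, hB] at hest
  exact sign_iff_of_abs_sub_le_mul hest (by linarith)

end Summit.Ventures.CertifiedArithmetic.Expansions
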